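import Summits.CriticalPhenomena.PercolationContinuityZ3.Theorems.PercNearOneGluingNoHeavyLowerTailCoSunflowerGlue
import Summits.CriticalPhenomena.PercolationContinuityZ3.Theorems.SoloBlindChainingBound
import Literature.Probability.Percolation.PercolationEvents
import HarnessLib

/-!
# No pair is pivotal for `U = {a ↔ s} ∪ {a ↔ c}` and for `D = {s ↮ c}` in the same configuration (Sahi programme, prover prim-sahi-p2 gen 44)

Support file (`--supports stmt-CriticalPhenomena-4575`, helper).  No definitions, no named facts, no sorries.
Memo `run/shared/lean/prim/prim-sahi/FROM-prim-sahi-p2-gen44-TELESCOPING.md` §3; `prim-sahi-p2/PROOF-E3.md` §54 (54c).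

The halving lemma (v) `μ(U)·μ(D) ≤ 2·μ(U ∩ D)` of gens 41–44 concerns the increasing event `U = {a ↔ s or a ↔ c}` and the decreasing
event `D = {s ↮ c}` of bond percolation on a finite graph.  Gen 44's telescoping identity writes `bad − good` (resp. `μ(U)μ(D) − μ(U∩D)`)
as a sum, along any adaptive order of the pairs, of "doubly pivotal" counts; its first term vanishes because of the elementary fact proved
here: a single pair `e = s(u,v)` can never be pivotal for `U` and for `D` in the same configuration (in `ω ∖ e` the three terminals would lie
in three distinct clusters, and one pair merges only two of them).  Consequences recorded in the memo: `#{U(x), D(x ⊕ e)} = #{U(x), D(x)}`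
for every pair `e` (complementary coupling), `μ(U ∩ D) = p_e·μ(U(ω), D(ω ∪ e)) + (1−p_e)·μ(U(ω), D(ω ∖ e))`, and the mixed-pair recursion
`good(H) = g(H/e, H∖e) + g(H∖e, H/e)`.  [this work] (reachability bookkeeping reused from the tree: `CoSunflowerGlue.mem_openConn_insert_iff`,
`mem_openConn_trans`, `mem_openConn_symm`)
-/

namespace Summit.CriticalPhenomena.PercolationContinuityZ3.Theorems

namespace HalvingPivot

open Literature.Probability.Percolation Literature.Probability.LatticeModels
open CoSunflowerGlue (mem_openConn_insert_iff)

variable {V : Type*}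

/-- **No pair is doubly pivotal (open-pair form).**  If `s ↮ c` in `ω` but `s ↔ c` in `ω ∪ {uv}`, and `a` is joined to neither `s` nor `c`
in `ω`, then `a` is joined to neither `s` nor `c` in `ω ∪ {uv}` either: the pair that merges the clusters of `s` and `c` cannot also attach
the cluster of `a`. [this work] -/
theorem not_conn_insert_of_merge (ω : BondConfig V) (u v s a c : V)
    (hD₀ : ω ∉ openConn s c) (hD₁ : insert s(u, v) ω ∈ openConn s c)
    (hs : ω ∉ openConn s a) (hc : ω ∉ openConn c a) :
    insert s(u, v) ω ∉ openConn s a ∧ insert s(u, v) ω ∉ openConn c a := by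
  rw [mem_openConn_insert_iff ω u v s c] at hD₁
  rcases hD₁ with h | ⟨hsu, hvc⟩ | ⟨hsv, huc⟩
  · exact absurd h hD₀
  · -- s ~ u and v ~ c in ω
    refine ⟨fun h => ?_, fun h => ?_⟩
    · rw [mem_openConn_insert_iff ω u v s a] at h
      rcases h with h | ⟨_, hva⟩ | ⟨_, hua⟩
      · exact hs h
      · exact hc (mem_openConn_trans (mem_openConn_symm hvc) hva)
      · exact hs (mem_openConn_trans hsu hua)
    · rw [mem_openConn_insert_iff ω u v c a] at h
      rcases h with h | ⟨_, hva⟩ | ⟨_, hua⟩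
      · exact hc h
      · exact hc (mem_openConn_trans (mem_openConn_symm hvc) hva)
      · exact hs (mem_openConn_trans hsu hua)
  · -- s ~ v and u ~ c in ω
    refine ⟨fun h => ?_, fun h => ?_⟩
    · rw [mem_openConn_insert_iff ω u v s a] at h
      rcases h with h | ⟨_, hva⟩ | ⟨_, hua⟩
      · exact hs h
      · exact hs (mem_openConn_trans hsv hva)
      · exact hc (mem_openConn_trans (mem_openConn_symm huc) hua)
    · rw [mem_openConn_insert_iff ω u v c a] at h
      rcases h with h | ⟨_, hva⟩ | ⟨_, hua⟩
      · exact hc h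
      · exact hs (mem_openConn_trans hsv hva)
      · exact hc (mem_openConn_trans (mem_openConn_symm huc) hua)

/-- **No pair is pivotal for `U = {a↔s} ∪ {a↔c}` and `D = {s↮c}` at the same configuration** (`IsPivotal` of `PercolationEvents`):
for every configuration `ω` and every pair `e`, `¬ (IsPivotal U e ω ∧ IsPivotal D e ω)`. [this work] -/
theorem not_isPivotal_both (ω : BondConfig V) (e : Sym2 V) (s a c : V) :
    ¬ (IsPivotal (openConn s a ∪ openConn c a : Set (BondConfig V)) e ω ∧
        IsPivotal ((openConn s c)ᶜ : Set (BondConfig V)) e ω) := by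
  induction e using Sym2.ind with
  | h u v =>
  rintro ⟨hU, hD⟩
  -- work with ω' := ω ∖ {e}; `insert e ω = insert e ω'`
  set ω' : BondConfig V := ω \ {s(u, v)} with hω'
  have hins : insert s(u, v) ω = insert s(u, v) ω' := by rw [hω', Set.insert_sdiff_singleton]
  unfold IsPivotal at hU hD
  rw [hins] at hU hD
  -- monotonicity through `mem_openConn_insert` (first disjunct)
  have monoU : ω' ∈ (openConn s a ∪ openConn c a : Set (BondConfig V)) →
      insert s(u, v) ω' ∈ (openConn s a ∪ openConn c a : Set (BondConfig V)) := by
    rintro (h | h)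
    · exact Or.inl ((mem_openConn_insert_iff ω' u v s a).2 (Or.inl h))
    · exact Or.inr ((mem_openConn_insert_iff ω' u v c a).2 (Or.inl h))
  have monoS : ω' ∈ openConn s c → insert s(u, v) ω' ∈ openConn s c :=
    fun h => (mem_openConn_insert_iff ω' u v s c).2 (Or.inl h)
  -- unpack the two exclusive ors
  have hU' : insert s(u, v) ω' ∈ (openConn s a ∪ openConn c a : Set (BondConfig V)) ∧
      ω' ∉ (openConn s a ∪ openConn c a : Set (BondConfig V)) := by
    rcases hU with ⟨h1, h2⟩ | ⟨h1, h2⟩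
    · exact ⟨h1, h2⟩
    · exact absurd (monoU h1) h2
  have hD' : ω' ∉ openConn s c ∧ insert s(u, v) ω' ∈ openConn s c := by
    rcases hD with ⟨h1, h2⟩ | ⟨h1, h2⟩
    · -- insert ∈ Dᶜᶜ?  h1 : insert ∈ (openConn s c)ᶜ, h2 : ω' ∉ (openConn s c)ᶜ
      exact absurd (monoS (not_not.1 h2)) h1
    · exact ⟨h1, not_not.1 h2⟩
  have hs : ω' ∉ openConn s a := fun h => hU'.2 (Or.inl h)
  have hc : ω' ∉ openConn c a := fun h => hU'.2 (Or.inr h)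
  obtain ⟨h1, h2⟩ := not_conn_insert_of_merge ω' u v s a c hD'.1 hD'.2 hs hc
  rcases hU'.1 with h | h
  · exact h1 h
  · exact h2 h

end HalvingPivot

end Summit.CriticalPhenomena.PercolationContinuityZ3.Theorems
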